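import Mathlib
import HarnessLib
import Literature.Analysis.FluidPDE.NewtonPotentialHolder
import Literature.Analysis.FluidPDE.WeakSolution
import Summits.NavierStokesRegularity.NavierStokesRegularity.Theorems.ChiralWindowDoorDefs
import Summits.NavierStokesRegularity.NavierStokesRegularity.Theorems.CriticalFluxDoorDefs
import Summits.NavierStokesRegularity.NavierStokesRegularity.Theorems.RellichScarDefs
import Summits.NavierStokesRegularity.NavierStokesRegularity.Theorems.ChiralWindowDoorLocalHelicityLower
import Summits.NavierStokesRegularity.NavierStokesRegularity.Theorems.CriticalFluxDoorLambdaSymmetry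
import Summits.NavierStokesRegularity.NavierStokesRegularity.Theorems.CriticalFluxDoorTimeDeriv
import Summits.NavierStokesRegularity.NavierStokesRegularity.Theorems.CriticalFluxDoorLambdaCompact
import Summits.NavierStokesRegularity.NavierStokesRegularity.Theorems.CriticalFluxDoorCommutatorPointwise

/-!
# Door S21-C «CriticalFluxDoor» — the COMMUTATOR PAIRING `∫⟪[Λ,a_R]v, ∂ₜv⟫` reduced to two radial integrals
# (F3-DERIVATION §2 (c): near zone, annulus, far zone)

Door S21-C of nsreg-p1's local Type-I door family (`HOME/ns-regularity-ideate-p1/ROUND-20.md` §2b F3,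
`r20/F3-DERIVATION.md` §2 (c); DESIGN-ONLY, route NOT born).  For a classical unit-viscosity solution `(v, q)` on the open
backward axis with the scale-invariant package, the weights `a_R = η(·/R)²`, `t = −s < 0`, `σ = √s`:

* `slice_sizes` — `‖v(t)‖ ≤ V = |L₀|/σ`, `‖∇v(t,y)‖ ≤ G = |L₁|/(R/2+σ)²` on `‖y‖ ≥ R/2`, `‖∂ₜv(t,x)‖ ≤ W/(‖x‖+σ)³`;
* `norm_lamComm_far` — **far zone**: for `‖x‖ ≥ 4R`, `a_R(x) = 0` so `[Λ,a_R]v(x) = Λ(a_R v)(x)` and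
  `‖[Λ,a_R]v(x)‖ ≤ (16/π²)·(V·(2R)³|B₁|)·‖x‖⁻⁴` (`…LambdaCompact.norm_fracLapHalf_le_of_support`);
* `abs_commutatorPairing_le` — **`|∫⟪[Λ,a_R]v, ∂ₜv⟫| ≤ (c₁V/R)·W·I₁ + c₂G·W·(3R/4+σ)⁻³·(4R)³|B₁| + (16/π²)V(2R)³|B₁|·W·I₃`**,
  with the radial integrals `I₁ = ∫_{B_{4R}}((‖x‖+σ)³)⁻¹dx` and `I₃ = ∫_{B_{4R}ᶜ}(‖x‖⁴)⁻¹((‖x‖+σ)³)⁻¹dx`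
  (pointwise near/annulus bound of `…CommutatorPointwise`; no integrability of the pairing itself is needed).

The two-regime evaluation of `I₁`, `I₃` and the time integration are `…CriticalFluxDoorCommutatorKernel`.

Seat nsreg-p6 g13 (THEOREMS-ONLY door sequels, DIRECTOR-NS g8 #32 (2)/#36).  WHAT THIS IS NOT: not NS regularity (Clay A);
flux bookkeeping; no route is opened.
-/

noncomputable section

-- the summit and its single sub-problem share the name (CONVENTIONS §1), as in every Theorems file
set_option linter.dupNamespace false

namespace Summit.NavierStokesRegularity.NavierStokesRegularity.Theorems.CriticalFluxDoorCommutatorPairing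

open MeasureTheory Metric Set Filter Topology Function
open scoped RealInnerProductSpace
open Literature.Analysis Literature.Analysis.FluidPDE
open Summit.NavierStokesRegularity.NavierStokesRegularity.Theorems.ChiralWindowDoorDefs
open Summit.NavierStokesRegularity.NavierStokesRegularity.Theorems.CriticalFluxDoorDefs
open Summit.NavierStokesRegularity.NavierStokesRegularity.Theorems.RellichScarScarRigidity (ScaleInvariantBounds)
open Summit.NavierStokesRegularity.NavierStokesRegularity.Theorems.ChiralWindowDoorLocalHelicityLower
  (contDiff_bumpSq hasCompactSupport_bumpSq continuous_bumpSq)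
open Summit.NavierStokesRegularity.NavierStokesRegularity.Theorems.CriticalFluxDoorLambdaSymmetry (fracLapHalf_smul_eq_lamComm)
open Summit.NavierStokesRegularity.NavierStokesRegularity.Theorems.CriticalFluxDoorTimeDeriv (exists_timeDeriv_bound_zero)
open Summit.NavierStokesRegularity.NavierStokesRegularity.Theorems.CriticalFluxDoorLambdaCompact (norm_fracLapHalf_le_of_support)
open Summit.NavierStokesRegularity.NavierStokesRegularity.Theorems.CriticalFluxDoorCommutatorPointwise
  (exists_norm_lamComm_bumpSq_le)

variable {η : EuclideanSpace ℝ (Fin 3) → ℝ} {v : ℝ → EuclideanSpace ℝ (Fin 3) → EuclideanSpace ℝ (Fin 3)}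
  {q : ℝ → EuclideanSpace ℝ (Fin 3) → ℝ}

/-! ### Sizes of the slice -/

/-- **Sizes of a slice** `t < 0` (`σ = √(−t)`): `‖v(t)‖ ≤ |L₀|/σ`, `‖D²v(t)‖ ≤ |L₂|/σ³`, and on `‖y‖ ≥ R/2`
`‖∇v(t,y)‖ ≤ |L₁|/(R/2+σ)²`, from the scale-invariant package. -/
theorem slice_sizes (hSIB : ScaleInvariantBounds v q) :
    ∃ L₀ L₁ L₂ : ℝ, 0 ≤ L₀ ∧ 0 ≤ L₁ ∧ 0 ≤ L₂ ∧ ∀ t < (0 : ℝ),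
      (∀ y, ‖v t y‖ ≤ L₀ / Real.sqrt (-t)) ∧ (∀ y, ‖iteratedFDeriv ℝ 2 (v t) y‖ ≤ L₂ / Real.sqrt (-t) ^ 3) ∧
      ∀ R > (0 : ℝ), ∀ y, R / 2 ≤ ‖y‖ → ‖fderiv ℝ (v t) y‖ ≤ L₁ / (R / 2 + Real.sqrt (-t)) ^ 2 := by
  obtain ⟨L₀, hL₀⟩ := hSIB 0
  obtain ⟨L₁, hL₁⟩ := hSIB 1
  obtain ⟨L₂, hL₂⟩ := hSIB 2
  refine ⟨|L₀|, |L₁|, |L₂|, abs_nonneg _, abs_nonneg _, abs_nonneg _, fun t ht => ⟨fun y => ?_, fun y => ?_, fun R hR y hy => ?_⟩⟩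
  · have hsq : 0 < Real.sqrt (-t) := Real.sqrt_pos.2 (neg_pos.2 ht)
    have h := (hL₀ t ht y).1
    rw [norm_iteratedFDeriv_zero, add_zero, pow_one] at h
    calc ‖v t y‖ ≤ L₀ / (‖y‖ + Real.sqrt (-t)) := h
      _ ≤ |L₀| / (‖y‖ + Real.sqrt (-t)) := div_le_div_of_nonneg_right (le_abs_self _) (by positivity)
      _ ≤ |L₀| / Real.sqrt (-t) := div_le_div_of_nonneg_left (abs_nonneg _) hsq (by linarith [norm_nonneg y])
  · have hsq : 0 < Real.sqrt (-t) := Real.sqrt_pos.2 (neg_pos.2 ht)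
    calc ‖iteratedFDeriv ℝ 2 (v t) y‖ ≤ L₂ / (‖y‖ + Real.sqrt (-t)) ^ (1 + 2) := (hL₂ t ht y).1
      _ ≤ |L₂| / (‖y‖ + Real.sqrt (-t)) ^ (1 + 2) := div_le_div_of_nonneg_right (le_abs_self _) (by positivity)
      _ ≤ |L₂| / Real.sqrt (-t) ^ 3 := div_le_div_of_nonneg_left (abs_nonneg _) (by positivity)
          (pow_le_pow_left₀ hsq.le (by linarith [norm_nonneg y]) _)
  · have hsq : 0 < Real.sqrt (-t) := Real.sqrt_pos.2 (neg_pos.2 ht)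
    have h := (hL₁ t ht y).1
    rw [norm_iteratedFDeriv_one] at h
    have hb : 0 < R / 2 + Real.sqrt (-t) := by positivity
    calc ‖fderiv ℝ (v t) y‖ ≤ L₁ / (‖y‖ + Real.sqrt (-t)) ^ (1 + 1) := h
      _ ≤ |L₁| / (‖y‖ + Real.sqrt (-t)) ^ (1 + 1) := div_le_div_of_nonneg_right (le_abs_self _) (by positivity)
      _ ≤ |L₁| / (R / 2 + Real.sqrt (-t)) ^ 2 := div_le_div_of_nonneg_left (abs_nonneg _) (by positivity)
          (pow_le_pow_left₀ hb.le (by linarith) 2)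

/-! ### The far zone -/

/-- **Far zone**: for `‖x‖ ≥ 4R` the commutator is `Λ(a_R v)(x)` and
`‖[Λ,a_R]f(x)‖ ≤ (16/π²)·(V·((2R)³|B₁|))·(‖x‖⁴)⁻¹` for a `C²` field with `‖f‖ ≤ V` and bounded `D²f`. -/
theorem norm_lamComm_far (hη : IsAdmissibleBump η) {R : ℝ} (hR : 0 < R)
    {f : EuclideanSpace ℝ (Fin 3) → EuclideanSpace ℝ (Fin 3)} (hf : ContDiff ℝ 2 f) {V N₂ : ℝ} (hV : ∀ y, ‖f y‖ ≤ V)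
    (hN₂ : ∀ y, ‖iteratedFDeriv ℝ 2 f y‖ ≤ N₂) {x : EuclideanSpace ℝ (Fin 3)} (hx : 4 * R ≤ ‖x‖) :
    ‖lamComm (bumpSq η R) f x‖ ≤
      16 / Real.pi ^ 2 * (V * ((2 * R) ^ 3 * (volume : Measure (EuclideanSpace ℝ (Fin 3))).real (ball 0 1))) *
        (‖x‖ ^ 4)⁻¹ := by
  have hV0 : 0 ≤ V := (norm_nonneg _).trans (hV 0)
  set g : EuclideanSpace ℝ (Fin 3) → EuclideanSpace ℝ (Fin 3) := fun y => bumpSq η R y • f y with hg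
  -- the commutator is `Λ(a_R f)` there
  have hax : bumpSq η R x = 0 := bumpSq_eq_zero hη hR (by linarith)
  have hsplit := fracLapHalf_smul_eq_lamComm (contDiff_bumpSq hη R) (hasCompactSupport_bumpSq hη hR) hf hV hN₂ x
  have hcomm : lamComm (bumpSq η R) f x = fracLapHalf g x := by
    rw [hg, hsplit, hax, zero_smul, zero_add]
  -- `a_R f` is integrable, supported in `B̄_{2R}`, with `∫‖a_R f‖ ≤ V·|B̄_{2R}|`
  have hgc : Continuous g := (continuous_bumpSq hη R).smul hf.continuous
  have hgs : HasCompactSupport g := (hasCompactSupport_bumpSq hη hR).smul_right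
  have hgi : Integrable g := hgc.integrable_of_hasCompactSupport hgs
  have hsupp : ∀ y, 2 * R < ‖y‖ → g y = 0 := fun y hy => by
    rw [hg]; dsimp only; rw [bumpSq_eq_zero hη hR hy.le, zero_smul]
  have hL1 : ∫ y, ‖g y‖ ≤ V * ((2 * R) ^ 3 * (volume : Measure (EuclideanSpace ℝ (Fin 3))).real (ball 0 1)) := by
    have hbd : ∀ y, ‖g y‖ ≤ (closedBall (0 : EuclideanSpace ℝ (Fin 3)) (2 * R)).indicator (fun _ => V) y := by
      intro y
      by_cases hy : y ∈ closedBall (0 : EuclideanSpace ℝ (Fin 3)) (2 * R)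
      · rw [indicator_of_mem hy, hg]; dsimp only
        rw [norm_smul, Real.norm_eq_abs, abs_of_nonneg (bumpSq_nonneg η R y)]
        calc bumpSq η R y * ‖f y‖ ≤ 1 * V := mul_le_mul (bumpSq_le_one hη R y) (hV y) (norm_nonneg _) zero_le_one
          _ = V := one_mul V
      · rw [indicator_of_notMem hy]
        have hy' : 2 * R < ‖y‖ := by simpa [mem_closedBall, dist_zero_right] using hy
        rw [hsupp y hy', norm_zero]
    have hint : Integrable ((closedBall (0 : EuclideanSpace ℝ (Fin 3)) (2 * R)).indicator fun _ => V) :=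
      IntegrableOn.integrable_indicator (integrableOn_const (measure_closedBall_lt_top.ne)) measurableSet_closedBall
    calc ∫ y, ‖g y‖ ≤ ∫ y, (closedBall (0 : EuclideanSpace ℝ (Fin 3)) (2 * R)).indicator (fun _ => V) y :=
          integral_mono hgi.norm hint hbd
      _ = V * ((2 * R) ^ 3 * (volume : Measure (EuclideanSpace ℝ (Fin 3))).real (ball 0 1)) := by
          rw [integral_indicator_const V measurableSet_closedBall, smul_eq_mul,
            Measure.addHaar_real_closedBall volume (0 : EuclideanSpace ℝ (Fin 3)) (by positivity : (0 : ℝ) ≤ 2 * R),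
            finrank_euclideanSpace_fin]
          ring
  rw [hcomm]
  have hρ : 0 < 2 * R := by positivity
  have hx' : 2 * (2 * R) ≤ ‖x‖ := by linarith
  refine (norm_fracLapHalf_le_of_support hgi hρ hsupp hx').trans ?_
  have hxpos : 0 < ‖x‖ := by linarith
  gcongr

/-! ### The pairing, reduced to two radial integrals -/

/-- **The commutator pairing reduced to radial integrals.**  For a classical unit-viscosity solution with the
scale-invariant package and the weights `a_R` of an admissible bump there are constants `c₁, c₂, W, L₀, L₁ ≥ 0` such that
for all `R > 0`, `t < 0` (`σ = √(−t)`):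
`|∫⟪[Λ,a_R]v(t), ∂ₜv(t)⟫| ≤ (c₁(L₀/σ)/R)·W·∫_{B_{4R}}((‖x‖+σ)³)⁻¹ + c₂(L₁/(R/2+σ)²)·W·((3R/4+σ)³)⁻¹·(4R)³|B₁|
  + (16/π²)(L₀/σ)(2R)³|B₁|·W·∫_{B_{4R}ᶜ}(‖x‖⁴)⁻¹((‖x‖+σ)³)⁻¹`. -/
theorem abs_commutatorPairing_le (hη : IsAdmissibleBump η) (hsol : IsClassicalNSSolutionOn (Iio (0 : ℝ)) 1 0 v q)
    (hSIB : ScaleInvariantBounds v q) :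
    ∃ c₁ c₂ W L₀ L₁ : ℝ, 0 ≤ c₁ ∧ 0 ≤ c₂ ∧ 0 ≤ W ∧ 0 ≤ L₀ ∧ 0 ≤ L₁ ∧ ∀ R > (0 : ℝ), ∀ t < (0 : ℝ),
      |∫ x, ⟪lamComm (bumpSq η R) (v t) x, timeDeriv v t x⟫| ≤
        (c₁ * (L₀ / Real.sqrt (-t)) / R) * W *
            (∫ x in ball (0 : EuclideanSpace ℝ (Fin 3)) (4 * R), ((‖x‖ + Real.sqrt (-t)) ^ 3)⁻¹) +
          c₂ * (L₁ / (R / 2 + Real.sqrt (-t)) ^ 2) * W * ((3 * R / 4 + Real.sqrt (-t)) ^ 3)⁻¹ *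
            ((4 * R) ^ 3 * (volume : Measure (EuclideanSpace ℝ (Fin 3))).real (ball 0 1)) +
          16 / Real.pi ^ 2 * ((L₀ / Real.sqrt (-t)) *
              ((2 * R) ^ 3 * (volume : Measure (EuclideanSpace ℝ (Fin 3))).real (ball 0 1))) * W *
            (∫ x in (ball (0 : EuclideanSpace ℝ (Fin 3)) (4 * R))ᶜ, (‖x‖ ^ 4)⁻¹ * ((‖x‖ + Real.sqrt (-t)) ^ 3)⁻¹) := by
  obtain ⟨c₁, c₂, hc₁, hc₂, hpt⟩ := exists_norm_lamComm_bumpSq_le hη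
  obtain ⟨W, hW0, hW⟩ := exists_timeDeriv_bound_zero hsol hSIB
  obtain ⟨L₀, L₁, L₂, hL₀, hL₁, -, hsz⟩ := slice_sizes hSIB
  set V₁ : ℝ := (volume : Measure (EuclideanSpace ℝ (Fin 3))).real (ball 0 1) with hV₁
  have hV₁0 : 0 ≤ V₁ := measureReal_nonneg
  refine ⟨c₁, c₂, W, L₀, L₁, hc₁, hc₂, hW0, hL₀, hL₁, fun R hR t ht => ?_⟩
  have hsq : 0 < Real.sqrt (-t) := Real.sqrt_pos.2 (neg_pos.2 ht)
  set σ : ℝ := Real.sqrt (-t) with hσ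
  obtain ⟨hV, hD2, hGR⟩ := hsz t ht
  set V : ℝ := L₀ / σ with hVdef
  set G : ℝ := L₁ / (R / 2 + σ) ^ 2 with hGdef
  have hV0 : 0 ≤ V := by positivity
  have hG0 : 0 ≤ G := by positivity
  have hG : ∀ y, R / 2 ≤ ‖y‖ → ‖fderiv ℝ (v t) y‖ ≤ G := hGR R hR
  have hvC : ContDiff ℝ 2 (v t) := contDiff_infty.1 (hsol.contDiff_velocity ht) 2
  have hvd : Differentiable ℝ (v t) := hvC.differentiable (by norm_num)
  -- pointwise near/annulus and far bounds
  have hnear : ∀ x, ‖lamComm (bumpSq η R) (v t) x‖ ≤ c₁ * V / R + (if 3 * R / 4 ≤ ‖x‖ then c₂ * G else 0) :=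
    hpt R hR (v t) V G hvd hV hG0 hG
  set cF : ℝ := 16 / Real.pi ^ 2 * (V * ((2 * R) ^ 3 * V₁)) with hcF
  have hcF0 : 0 ≤ cF := by positivity
  have hfar : ∀ x, 4 * R ≤ ‖x‖ → ‖lamComm (bumpSq η R) (v t) x‖ ≤ cF * (‖x‖ ^ 4)⁻¹ := fun x hx =>
    norm_lamComm_far hη hR hvC hV hD2 hx
  have hw : ∀ x, ‖timeDeriv v t x‖ ≤ W / (‖x‖ + σ) ^ 3 := hW t ht
  -- the majorant
  set kN : ℝ := c₁ * V / R * W with hkN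
  set kA : ℝ := c₂ * G * W * ((3 * R / 4 + σ) ^ 3)⁻¹ with hkA
  set kF : ℝ := cF * W with hkF
  have hkN0 : 0 ≤ kN := by positivity
  have hkA0 : 0 ≤ kA := by positivity
  have hkF0 : 0 ≤ kF := by positivity
  set Φ : EuclideanSpace ℝ (Fin 3) → ℝ := fun x =>
    (ball (0 : EuclideanSpace ℝ (Fin 3)) (4 * R)).indicator (fun x => kN * ((‖x‖ + σ) ^ 3)⁻¹ + kA) x +
      (ball (0 : EuclideanSpace ℝ (Fin 3)) (4 * R))ᶜ.indicator (fun x => kF * ((‖x‖ ^ 4)⁻¹ * ((‖x‖ + σ) ^ 3)⁻¹)) x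
    with hΦ
  -- pointwise domination of the pairing integrand
  have hdom : ∀ x, ‖⟪lamComm (bumpSq η R) (v t) x, timeDeriv v t x⟫‖ ≤ Φ x := by
    intro x
    have hprod : ‖⟪lamComm (bumpSq η R) (v t) x, timeDeriv v t x⟫‖ ≤
        ‖lamComm (bumpSq η R) (v t) x‖ * (W / (‖x‖ + σ) ^ 3) := by
      rw [Real.norm_eq_abs]
      exact (abs_real_inner_le_norm _ _).trans (mul_le_mul_of_nonneg_left (hw x) (norm_nonneg _))
    have hden : 0 < (‖x‖ + σ) ^ 3 := by positivity
    by_cases hx : x ∈ ball (0 : EuclideanSpace ℝ (Fin 3)) (4 * R)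
    · have hxc : x ∉ (ball (0 : EuclideanSpace ℝ (Fin 3)) (4 * R))ᶜ := fun h => h hx
      rw [hΦ]; dsimp only; rw [indicator_of_mem hx, indicator_of_notMem hxc, add_zero]
      refine hprod.trans ?_
      have hx' : ‖x‖ < 4 * R := mem_ball_zero_iff.1 hx
      calc ‖lamComm (bumpSq η R) (v t) x‖ * (W / (‖x‖ + σ) ^ 3)
          ≤ (c₁ * V / R + (if 3 * R / 4 ≤ ‖x‖ then c₂ * G else 0)) * (W / (‖x‖ + σ) ^ 3) :=
            mul_le_mul_of_nonneg_right (hnear x) (by positivity)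
        _ = kN * ((‖x‖ + σ) ^ 3)⁻¹ + (if 3 * R / 4 ≤ ‖x‖ then c₂ * G else 0) * (W / (‖x‖ + σ) ^ 3) := by
            rw [hkN]; ring
        _ ≤ kN * ((‖x‖ + σ) ^ 3)⁻¹ + kA := by
            gcongr
            split_ifs with h34
            · rw [hkA, div_eq_mul_inv, ← mul_assoc]
              refine mul_le_mul_of_nonneg_left (inv_anti₀ (by positivity) ?_) (by positivity)
              exact pow_le_pow_left₀ (by positivity) (by linarith) 3
            · rw [zero_mul]; exact hkA0
    · have hxc : x ∈ (ball (0 : EuclideanSpace ℝ (Fin 3)) (4 * R))ᶜ := hx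
      have hx' : 4 * R ≤ ‖x‖ := by simpa [mem_ball, dist_zero_right] using hx
      rw [hΦ]; dsimp only; rw [indicator_of_notMem hx, indicator_of_mem hxc, zero_add]
      refine hprod.trans ?_
      calc ‖lamComm (bumpSq η R) (v t) x‖ * (W / (‖x‖ + σ) ^ 3) ≤ cF * (‖x‖ ^ 4)⁻¹ * (W / (‖x‖ + σ) ^ 3) :=
            mul_le_mul_of_nonneg_right (hfar x hx') (by positivity)
        _ = kF * ((‖x‖ ^ 4)⁻¹ * ((‖x‖ + σ) ^ 3)⁻¹) := by rw [hkF, div_eq_mul_inv]; ring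
  -- integrability of the pieces
  have hc3 : Continuous fun x : EuclideanSpace ℝ (Fin 3) => ((‖x‖ + σ) ^ 3)⁻¹ :=
    Continuous.inv₀ (by fun_prop) fun x => by positivity
  have hI1 : IntegrableOn (fun x : EuclideanSpace ℝ (Fin 3) => ((‖x‖ + σ) ^ 3)⁻¹) (ball 0 (4 * R)) := by
    refine Measure.integrableOn_of_bounded (M := (σ ^ 3)⁻¹) measure_ball_lt_top.ne hc3.aestronglyMeasurable
      (ae_of_all _ fun x => ?_)
    rw [Real.norm_eq_abs, abs_of_nonneg (by positivity)]
    exact inv_anti₀ (by positivity) (pow_le_pow_left₀ hsq.le (by linarith [norm_nonneg x]) 3)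
  have hI3 : IntegrableOn (fun x : EuclideanSpace ℝ (Fin 3) => (‖x‖ ^ 4)⁻¹ * ((‖x‖ + σ) ^ 3)⁻¹) (ball 0 (4 * R))ᶜ := by
    have h7 := NewtonPotentialHolder.integrableOn_compl_ball_norm_rpow_neg (t := 7) (by norm_num) (by positivity : 0 < 4 * R)
    refine Integrable.mono' h7 ?_ ((ae_restrict_iff' measurableSet_ball.compl).2 (ae_of_all _ fun x hx => ?_))
    · exact (((continuous_norm.measurable.pow_const 4).inv).mul hc3.measurable).aestronglyMeasurable
    · have hx' : 4 * R ≤ ‖x‖ := by simpa [mem_ball, dist_zero_right] using hx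
      have hxpos : 0 < ‖x‖ := by linarith
      rw [Real.norm_eq_abs, abs_of_nonneg (by positivity), Real.rpow_neg hxpos.le,
        show (7 : ℝ) = ((7 : ℕ) : ℝ) by norm_num, Real.rpow_natCast]
      rw [← mul_inv, show ‖x‖ ^ 7 = ‖x‖ ^ 4 * ‖x‖ ^ 3 by ring]
      exact inv_anti₀ (by positivity) (mul_le_mul_of_nonneg_left
        (pow_le_pow_left₀ hxpos.le (by linarith) 3) (by positivity))
  have hP1 : Integrable (fun x => (ball (0 : EuclideanSpace ℝ (Fin 3)) (4 * R)).indicator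
      (fun x => kN * ((‖x‖ + σ) ^ 3)⁻¹ + kA) x) := by
    rw [integrable_indicator_iff measurableSet_ball]
    exact (hI1.const_mul kN).add (integrableOn_const measure_ball_lt_top.ne)
  have hP2 : Integrable (fun x => (ball (0 : EuclideanSpace ℝ (Fin 3)) (4 * R))ᶜ.indicator
      (fun x => kF * ((‖x‖ ^ 4)⁻¹ * ((‖x‖ + σ) ^ 3)⁻¹)) x) := by
    rw [integrable_indicator_iff measurableSet_ball.compl]
    exact hI3.const_mul kF
  have hΦi : Integrable Φ := by rw [hΦ]; exact hP1.add hP2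
  -- the integral of the majorant
  have hΦval : ∫ x, Φ x = kN * (∫ x in ball (0 : EuclideanSpace ℝ (Fin 3)) (4 * R), ((‖x‖ + σ) ^ 3)⁻¹) +
      kA * (volume : Measure (EuclideanSpace ℝ (Fin 3))).real (ball 0 (4 * R)) +
      kF * ∫ x in (ball (0 : EuclideanSpace ℝ (Fin 3)) (4 * R))ᶜ, (‖x‖ ^ 4)⁻¹ * ((‖x‖ + σ) ^ 3)⁻¹ := by
    rw [hΦ, integral_add hP1 hP2, integral_indicator measurableSet_ball, integral_indicator measurableSet_ball.compl,
      integral_add (hI1.const_mul kN) (integrableOn_const measure_ball_lt_top.ne), integral_const_mul,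
      setIntegral_const, integral_const_mul, smul_eq_mul]
    ring
  have hvol : (volume : Measure (EuclideanSpace ℝ (Fin 3))).real (ball 0 (4 * R)) ≤ (4 * R) ^ 3 * V₁ := by
    calc (volume : Measure (EuclideanSpace ℝ (Fin 3))).real (ball 0 (4 * R))
        ≤ (volume : Measure (EuclideanSpace ℝ (Fin 3))).real (closedBall 0 (4 * R)) :=
          measureReal_mono ball_subset_closedBall measure_closedBall_lt_top.ne
      _ = (4 * R) ^ 3 * V₁ := by
          rw [Measure.addHaar_real_closedBall volume (0 : EuclideanSpace ℝ (Fin 3)) (by positivity : (0 : ℝ) ≤ 4 * R),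
            finrank_euclideanSpace_fin]
  have hmain := (norm_integral_le_of_norm_le hΦi (ae_of_all _ hdom))
  rw [Real.norm_eq_abs, hΦval] at hmain
  refine hmain.trans ?_
  rw [hkN, hkA, hkF, hcF]
  have h2 : c₂ * G * W * ((3 * R / 4 + σ) ^ 3)⁻¹ * (volume : Measure (EuclideanSpace ℝ (Fin 3))).real (ball 0 (4 * R)) ≤
      c₂ * G * W * ((3 * R / 4 + σ) ^ 3)⁻¹ * ((4 * R) ^ 3 * V₁) := mul_le_mul_of_nonneg_left hvol (by positivity)
  linarith [h2]

end Summit.NavierStokesRegularity.NavierStokesRegularity.Theorems.CriticalFluxDoorCommutatorPairing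

end
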